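import Mathlib.Algebra.MvPolynomial.CommRing
import Mathlib.Algebra.MvPolynomial.Degrees
import Summits.KontsevichZagierPeriods.Zeta5Search.Certificates.PolyReflect

/-!
# The integer polynomial of a reflected expression: semantics, degree and 1-norm bounds (cell `pub-zeta5`, certifier `cert-1`)

HONEST FRAMING: systematic search; no irrationality claim unless certified.

Support for `Certificates/PolyKronecker.lean` (kernel polynomial identity testing by one Kronecker evaluation):
`peval` commutes with ring homomorphisms (`map_peval`), hence `peval e [a,b,c]` is the evaluation of the integer
polynomial `toMv e ∈ ℤ[v₀,v₁,v₂]` (`MvPolynomial ℕ ℤ`); structural recursions `degB i e` and `normB e` on the syntax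
tree bound `degreeOf i (toMv e)` and the 1-norm `L1 (toMv e) = Σ |coefficients|` (submultiplicativity `L1_mul`).
General tooling; no named facts.
-/

namespace Summit.KontsevichZagierPeriods.Zeta5Search.Certificates

namespace PolyReflect

open Lean.Grind.CommRing (Expr Var)
open MvPolynomial Finset

/-! ### `peval` commutes with ring homomorphisms -/

section Hom

variable {α β : Type*} [CommRing α] [CommRing β] (f : α →+* β)

/-- Lookup commutes with mapping the context. -/
theorem get_ctxGo_map : ∀ (l : List α) (s i : ℕ), (ctxGo s (l.map f)).get i = f ((ctxGo s l).get i)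
  | [], s, i => by simp [ctxGo, Lean.RArray.get]
  | [a], s, i => by simp [ctxGo, Lean.RArray.get]
  | a :: b :: l, s, i => by
      have ih := get_ctxGo_map (b :: l) (s + 1) i
      simp only [List.map_cons] at ih ⊢
      simp only [ctxGo, Lean.RArray.get]
      cases Nat.ble (s + 1) i
      · rfl
      · exact ih

/-- **`peval` is natural**: `f (peval e l) = peval e (l.map f)` for a ring homomorphism `f`. -/
theorem map_peval (l : List α) : ∀ e : Expr, f (peval e l) = peval e (l.map f)
  | .num k => by rw [peval_num, peval_num, map_intCast]
  | .natCast k => by rw [peval_natCast, peval_natCast, map_natCast]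
  | .intCast k => by rw [peval_intCast, peval_intCast, map_intCast]
  | .var i => by rw [peval_var, peval_var]; exact (get_ctxGo_map f l 0 i).symm
  | .neg a => by rw [peval_neg, peval_neg, map_neg, map_peval l a]
  | .add a b => by rw [peval_add, peval_add, map_add, map_peval l a, map_peval l b]
  | .sub a b => by rw [peval_sub, peval_sub, map_sub, map_peval l a, map_peval l b]
  | .mul a b => by rw [peval_mul, peval_mul, map_mul, map_peval l a, map_peval l b]
  | .pow a k => by rw [peval_pow, peval_pow, map_pow, map_peval l a]

end Hom

/-! ### The integer polynomial denoted by an expression in three variables -/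

/-- The polynomial `toMv e ∈ ℤ[v₀,v₁,v₂]` (as an `MvPolynomial ℕ ℤ`) denoted by `e`. -/
noncomputable def toMv (e : Expr) : MvPolynomial ℕ ℤ := peval e [X 0, X 1, X 2]

/-- `peval e [a,b,c]` is the evaluation of `toMv e` at `(a,b,c)`. -/
theorem peval_eq_eval₂_toMv {R : Type*} [CommRing R] (e : Expr) (a b c : R) :
    peval e [a, b, c] = eval₂Hom (Int.castRingHom R) (fun i => [a, b, c].getD i 0) (toMv e) := by
  rw [toMv, map_peval]
  simp

/-- `toMv` on sums. -/
theorem toMv_add (a b : Expr) : toMv (.add a b) = toMv a + toMv b := peval_add _ a b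
/-- `toMv` on differences. -/
theorem toMv_sub (a b : Expr) : toMv (.sub a b) = toMv a - toMv b := peval_sub _ a b
/-- `toMv` on products. -/
theorem toMv_mul (a b : Expr) : toMv (.mul a b) = toMv a * toMv b := peval_mul _ a b
/-- `toMv` on negations. -/
theorem toMv_neg (a : Expr) : toMv (.neg a) = -toMv a := peval_neg _ a
/-- `toMv` on powers. -/
theorem toMv_pow (a : Expr) (k : ℕ) : toMv (.pow a k) = toMv a ^ k := peval_pow _ a k
/-- `toMv` on numerals. -/
theorem toMv_num (k : ℤ) : toMv (.num k) = C k := by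
  rw [toMv, peval_num]; exact (map_intCast (C : ℤ →+* MvPolynomial ℕ ℤ) k).symm
/-- `toMv` on natural-number casts. -/
theorem toMv_natCast (k : ℕ) : toMv (.natCast k) = C (k : ℤ) := by
  rw [toMv, peval_natCast]; exact (map_natCast (C : ℤ →+* MvPolynomial ℕ ℤ) k).symm
/-- `toMv` on integer casts. -/
theorem toMv_intCast (k : ℤ) : toMv (.intCast k) = C k := by
  rw [toMv, peval_intCast]; exact (map_intCast (C : ℤ →+* MvPolynomial ℕ ℤ) k).symm
/-- `toMv` on the three variables. -/
theorem toMv_var (j : ℕ) (hj : j < 3) : toMv (.var j) = X j := by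
  rw [toMv, peval_var]
  interval_cases j <;> rfl

/-! ### Structural degree bounds -/

/-- Structural bound for the degree of `toMv e` in the variable `vᵢ`. -/
def degB (i : ℕ) : Expr → ℕ
  | .num _ => 0
  | .natCast _ => 0
  | .intCast _ => 0
  | .var j => if j = i then 1 else 0
  | .neg a => degB i a
  | .add a b => max (degB i a) (degB i b)
  | .sub a b => max (degB i a) (degB i b)
  | .mul a b => degB i a + degB i b
  | .pow a k => k * degB i a

/-- Variables that do not occur have structural degree `0`. -/
theorem degB_eq_zero (N i : ℕ) (hi : N ≤ i) : ∀ e : Expr, varsLT N e = true → degB i e = 0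
  | .num _, _ => rfl
  | .natCast _, _ => rfl
  | .intCast _, _ => rfl
  | .var j, hv => by
      simp only [varsLT, decide_eq_true_eq] at hv
      have hji : j ≠ i := by rintro rfl; exact absurd hv (not_lt.mpr hi)
      simp [degB, hji]
  | .neg a, hv => by simp only [varsLT] at hv; exact degB_eq_zero N i hi a hv
  | .add a b, hv => by
      simp only [varsLT, Bool.and_eq_true] at hv
      simp [degB, degB_eq_zero N i hi a hv.1, degB_eq_zero N i hi b hv.2]
  | .sub a b, hv => by
      simp only [varsLT, Bool.and_eq_true] at hv
      simp [degB, degB_eq_zero N i hi a hv.1, degB_eq_zero N i hi b hv.2]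
  | .mul a b, hv => by
      simp only [varsLT, Bool.and_eq_true] at hv
      simp [degB, degB_eq_zero N i hi a hv.1, degB_eq_zero N i hi b hv.2]
  | .pow a k, hv => by simp only [varsLT] at hv; simp [degB, degB_eq_zero N i hi a hv]

/-- **Degree bound**: `degreeOf i (toMv e) ≤ degB i e` for expressions in `v₀,v₁,v₂`. -/
theorem degreeOf_toMv_le (i : ℕ) : ∀ e : Expr, varsLT 3 e = true → degreeOf i (toMv e) ≤ degB i e
  | .num k, _ => by rw [toMv_num, degreeOf_C]; exact Nat.zero_le _
  | .natCast k, _ => by rw [toMv_natCast, degreeOf_C]; exact Nat.zero_le _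
  | .intCast k, _ => by rw [toMv_intCast, degreeOf_C]; exact Nat.zero_le _
  | .var j, hv => by
      simp only [varsLT, decide_eq_true_eq] at hv
      rw [toMv_var j hv, degreeOf_X, degB]
      by_cases h : i = j
      · subst h; simp
      · simp [h, Ne.symm h]
  | .neg a, hv => by
      simp only [varsLT] at hv
      rw [toMv_neg, degreeOf_neg]; exact degreeOf_toMv_le i a hv
  | .add a b, hv => by
      simp only [varsLT, Bool.and_eq_true] at hv
      rw [toMv_add, degB]
      exact (degreeOf_add_le i _ _).trans (max_le_max (degreeOf_toMv_le i a hv.1) (degreeOf_toMv_le i b hv.2))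
  | .sub a b, hv => by
      simp only [varsLT, Bool.and_eq_true] at hv
      rw [toMv_sub, degB]
      exact (degreeOf_sub_le i _ _).trans (max_le_max (degreeOf_toMv_le i a hv.1) (degreeOf_toMv_le i b hv.2))
  | .mul a b, hv => by
      simp only [varsLT, Bool.and_eq_true] at hv
      rw [toMv_mul, degB]
      exact (degreeOf_mul_le i _ _).trans (Nat.add_le_add (degreeOf_toMv_le i a hv.1) (degreeOf_toMv_le i b hv.2))
  | .pow a k, hv => by
      simp only [varsLT] at hv
      rw [toMv_pow, degB]
      exact (degreeOf_pow_le i _ k).trans (Nat.mul_le_mul_left k (degreeOf_toMv_le i a hv))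

/-! ### The 1-norm of an integer polynomial and its structural bound -/

/-- `L1 p = Σ_m |coeff m p|`. -/
def L1 (p : MvPolynomial ℕ ℤ) : ℕ := ∑ m ∈ p.support, (p.coeff m).natAbs

/-- A sum of `|coefficients|` over any finite set is at most `L1`. -/
theorem sum_natAbs_coeff_le_L1 (p : MvPolynomial ℕ ℤ) (S : Finset (ℕ →₀ ℕ)) :
    ∑ m ∈ S, (p.coeff m).natAbs ≤ L1 p := by
  classical
  calc ∑ m ∈ S, (p.coeff m).natAbs = ∑ m ∈ S ∩ p.support, (p.coeff m).natAbs := by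
        refine (sum_subset inter_subset_left fun m hmS hm => ?_).symm
        have : m ∉ p.support := fun h => hm (mem_inter.mpr ⟨hmS, h⟩)
        rw [notMem_support_iff.mp this, Int.natAbs_zero]
    _ ≤ L1 p := sum_le_sum_of_subset inter_subset_right

/-- A sum of a nonnegative function vanishing outside `W` is at most its sum over `W`. -/
theorem sum_le_sum_of_vanish {ι : Type*} [DecidableEq ι] (V W : Finset ι) (g : ι → ℕ)
    (h : ∀ x ∈ V, x ∉ W → g x = 0) : ∑ x ∈ V, g x ≤ ∑ x ∈ W, g x :=
  calc ∑ x ∈ V, g x = ∑ x ∈ V ∩ W, g x :=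
        (sum_subset inter_subset_left fun x hxV hx => h x hxV fun hW => hx (mem_inter.mpr ⟨hxV, hW⟩)).symm
    _ ≤ ∑ x ∈ W, g x := sum_le_sum_of_subset inter_subset_right

/-- `L1 (C c) ≤ |c|`. -/
theorem L1_C (c : ℤ) : L1 (C c : MvPolynomial ℕ ℤ) ≤ c.natAbs := by
  classical
  unfold L1
  calc ∑ m ∈ (C c : MvPolynomial ℕ ℤ).support, ((C c : MvPolynomial ℕ ℤ).coeff m).natAbs
      ≤ ∑ m ∈ ({0} : Finset (ℕ →₀ ℕ)), ((C c : MvPolynomial ℕ ℤ).coeff m).natAbs :=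
        sum_le_sum_of_vanish _ _ _ fun m _ hm => by
          rw [coeff_C, if_neg (fun h => hm (by rw [h]; exact mem_singleton_self _)), Int.natAbs_zero]
    _ = c.natAbs := by rw [sum_singleton, coeff_zero_C]

/-- `L1 (X i) ≤ 1`. -/
theorem L1_X (i : ℕ) : L1 (X i : MvPolynomial ℕ ℤ) ≤ 1 := by
  unfold L1
  rw [support_X, sum_singleton, coeff_X]
  simp

/-- `L1 (-p) = L1 p`. -/
theorem L1_neg (p : MvPolynomial ℕ ℤ) : L1 (-p) = L1 p := by
  unfold L1; rw [support_neg]; exact sum_congr rfl fun m _ => by rw [coeff_neg, Int.natAbs_neg]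

/-- `L1 (p + q) ≤ L1 p + L1 q`. -/
theorem L1_add (p q : MvPolynomial ℕ ℤ) : L1 (p + q) ≤ L1 p + L1 q := by
  unfold L1
  calc ∑ m ∈ (p + q).support, ((p + q).coeff m).natAbs
      ≤ ∑ m ∈ (p + q).support, ((p.coeff m).natAbs + (q.coeff m).natAbs) :=
        sum_le_sum fun m _ => by rw [coeff_add]; exact Int.natAbs_add_le _ _
    _ = ∑ m ∈ (p + q).support, (p.coeff m).natAbs + ∑ m ∈ (p + q).support, (q.coeff m).natAbs := sum_add_distrib
    _ ≤ L1 p + L1 q := Nat.add_le_add (sum_natAbs_coeff_le_L1 p _) (sum_natAbs_coeff_le_L1 q _)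

/-- `L1 (p - q) ≤ L1 p + L1 q`. -/
theorem L1_sub (p q : MvPolynomial ℕ ℤ) : L1 (p - q) ≤ L1 p + L1 q := by
  rw [sub_eq_add_neg]; exact (L1_add p (-q)).trans (by rw [L1_neg])

/-- `L1 (p * q) ≤ L1 p * L1 q` (the 1-norm is submultiplicative). -/
theorem L1_mul (p q : MvPolynomial ℕ ℤ) : L1 (p * q) ≤ L1 p * L1 q := by
  classical
  let g : (ℕ →₀ ℕ) × (ℕ →₀ ℕ) → ℕ := fun x => (p.coeff x.1).natAbs * (q.coeff x.2).natAbs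
  have h1 : L1 (p * q) ≤ ∑ n ∈ (p * q).support, ∑ x ∈ antidiagonal n, g x := by
    unfold L1
    refine sum_le_sum fun n _ => ?_
    rw [coeff_mul]
    refine (Int.natAbs_sum_le _ _).trans (le_of_eq (sum_congr rfl fun x _ => Int.natAbs_mul _ _))
  have h2 : ∑ n ∈ (p * q).support, ∑ x ∈ antidiagonal n, g x
      = ∑ x ∈ ((p * q).support.sigma fun n => antidiagonal n).image Sigma.snd, g x := by
    rw [sum_image]
    · exact sum_sigma' _ _ fun _ x => g x
    · rintro ⟨n, x⟩ hx ⟨n', x'⟩ hx' (hxx : x = x')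
      simp only [coe_sigma, Set.mem_sigma_iff, mem_coe, mem_antidiagonal] at hx hx'
      subst hxx
      have : n = n' := hx.2.symm.trans hx'.2
      subst this
      rfl
  have h3 : ∑ x ∈ ((p * q).support.sigma fun n => antidiagonal n).image Sigma.snd, g x
      ≤ ∑ x ∈ p.support ×ˢ q.support, g x :=
    sum_le_sum_of_vanish _ _ g fun x _ hx => by
      rw [mem_product, not_and_or, notMem_support_iff, notMem_support_iff] at hx
      rcases hx with hx | hx <;> simp [g, hx]
  have h4 : ∑ x ∈ p.support ×ˢ q.support, g x = L1 p * L1 q := by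
    rw [sum_product, L1, L1, sum_mul_sum]
  exact h1.trans (h2.le.trans (h3.trans h4.le))

/-- `L1 (p ^ k) ≤ (L1 p) ^ k`. -/
theorem L1_pow (p : MvPolynomial ℕ ℤ) : ∀ k : ℕ, L1 (p ^ k) ≤ L1 p ^ k
  | 0 => by rw [pow_zero, pow_zero, ← C_1]; exact L1_C 1
  | k + 1 => by rw [pow_succ, pow_succ]; exact (L1_mul _ _).trans (Nat.mul_le_mul_right _ (L1_pow p k))

/-- Structural bound for `L1 (toMv e)`. -/
def normB : Expr → ℕ
  | .num k => k.natAbs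
  | .natCast k => k
  | .intCast k => k.natAbs
  | .var _ => 1
  | .neg a => normB a
  | .add a b => normB a + normB b
  | .sub a b => normB a + normB b
  | .mul a b => normB a * normB b
  | .pow a k => normB a ^ k

/-- **Norm bound**: `L1 (toMv e) ≤ normB e` for expressions in `v₀,v₁,v₂`. -/
theorem L1_toMv_le : ∀ e : Expr, varsLT 3 e = true → L1 (toMv e) ≤ normB e
  | .num k, _ => by rw [toMv_num]; exact L1_C k
  | .natCast k, _ => by rw [toMv_natCast, normB]; exact (L1_C _).trans (by simp)
  | .intCast k, _ => by rw [toMv_intCast]; exact L1_C k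
  | .var j, hv => by
      simp only [varsLT, decide_eq_true_eq] at hv
      rw [toMv_var j hv]; exact L1_X j
  | .neg a, hv => by simp only [varsLT] at hv; rw [toMv_neg, L1_neg]; exact L1_toMv_le a hv
  | .add a b, hv => by
      simp only [varsLT, Bool.and_eq_true] at hv
      rw [toMv_add, normB]; exact (L1_add _ _).trans (Nat.add_le_add (L1_toMv_le a hv.1) (L1_toMv_le b hv.2))
  | .sub a b, hv => by
      simp only [varsLT, Bool.and_eq_true] at hv
      rw [toMv_sub, normB]; exact (L1_sub _ _).trans (Nat.add_le_add (L1_toMv_le a hv.1) (L1_toMv_le b hv.2))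
  | .mul a b, hv => by
      simp only [varsLT, Bool.and_eq_true] at hv
      rw [toMv_mul, normB]; exact (L1_mul _ _).trans (Nat.mul_le_mul (L1_toMv_le a hv.1) (L1_toMv_le b hv.2))
  | .pow a k, hv => by
      simp only [varsLT] at hv
      rw [toMv_pow, normB]; exact (L1_pow _ k).trans (Nat.pow_le_pow_left (L1_toMv_le a hv) k)

end PolyReflect

end Summit.KontsevichZagierPeriods.Zeta5Search.Certificates
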